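import Literature.IUT.LogVolume.PacketMonomialBox
import Literature.IUT.LogVolume.TameRamificationIndex
import HarnessLib

/-!
# The DUAL-BASIS BOX of a tensor packet: `(R_I)^∼` lies coordinatewise inside the tensor box of the TRACE-DUAL bases — [IUTchIV] Prop. 1.1 made
# coordinatewise at EVERY packet — and EQUALS the monomial box of any NORM-UNIMODULAR trace-dual pair; such pairs exist at every TAME packet
# (`p ∤ e_i`, ANY residue degrees, any mix of slot fields)

Classical local algebra (nothing disputed; the [IUTchIV] locator records where the abc-iut cell uses it).  abc-iut cell, seat abc-iut-c312-1 (gen 20;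
Cor. 3.12 sub-crew, row offer (λ) «factors with f > 1 in the converse», C LEAD abc-iut-plan).  PROOF-ONLY sequel of abc-iut-E-t58's `PacketMonomialBox.lean`
(Box ⊆ `(R_I)^∼` for EVERY family of slot bases; `(R_I)^∼ ⊆` Box at INCONGRUENT monomial norms) and of this seat's `PacketMonomialBoxRadical.lean` (gen 19:
`(R_I)^∼ ⊆` Box at RADICAL tame power bases `π_i^j`, `π_i^{e_i} ∈ ℚ_p`, `p ∤ e_i`, by a discrete Fourier transform — residue degree ONE only).  HERE the
residue-degree restriction disappears: no definition, no `Prop` fact, no `sorry`.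

Fix `ℚ_p`-bases `b^{(i)}` of the slots `k_i` and TRACE-DUAL families `d^{(i)}` (`Tr_{k_i/ℚ_p}(d^{(i)}_m · b^{(i)}_{m'}) = δ_{m m'}`), the tensor basis
`B_J = ⊗_i b^{(i)}_{J_i}` and the coordinates `z = Σ_J z_J B_J`.
* §1 **`norm_repr_le_prod_norm_of_traceDual`** — for EVERY packet (wild slots allowed) and every `z ∈ (R_I)^∼`: `‖z_J‖ ≤ ∏_i ‖d^{(i)}_{J_i}‖`.  Proof: for each
  family of embeddings `σ = (σ_i) ∈ ∏_i Hom_{ℚ_p}(k_i, ℚ̄_p)` the algebra map `Φ_σ = ⊗σ_i : V → ℚ̄_p` has `‖Φ_σ z‖ ≤ 1` (integrality, as in E-t58 §3), and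
  `Σ_σ Φ_σ(z)·∏_i σ_i(d^{(i)}_{J_i}) = Σ_{J′} z_{J′} ∏_i Σ_{σ_i} σ_i(b_{J′_i} d_{J_i}) = Σ_{J′} z_{J′} ∏_i Tr(b_{J′_i} d_{J_i}) = z_J` (Mathlib `trace_eq_sum_embeddings`);
  embeddings of the locally compact `k_i` are isometries.  A COORDINATEWISE companion of [IUTchIV] Prop. 1.1's different bound «`p^{d_{I*}}·(R_I)^∼ ⊆ R_I`»:
  `(R_I)^∼` lies in the trace dual `⊗_i 𝔡_i^{−1}` of `R_I` (spanned by the dual tensor basis `⊗_i d^{(i)}_{J_i}` of integral bases `b^{(i)}`), i.e.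
  `Tr_{V/ℚ_p}(z·B_J) ∈ ℤ_p`; here the sharper `‖Tr_{V/ℚ_p}(z·⊗_i d_{J_i})‖ = ‖z_J‖ ≤ ∏_i ‖d_{J_i}‖` is read off for the NON-integral test tensors `⊗_i d_{J_i}`.
* §2 **`box_of_mem_normalizedPacket_of_unimodular`** — if the pair is NORM-UNIMODULAR (`‖b_m‖·‖d_m‖ ≤ 1`, abc-iut-E-t42's `TameDualPair` shape) then
  `(R_I)^∼ ⊆ Box(b) = {z : ‖z_J‖·∏_i ‖b_{J_i}‖ ≤ 1 ∀J}`; with E-t58 §1 (`mem_normalizedPacket_of_box`) **`mem_normalizedPacket_iff_box_of_unimodular`: `(R_I)^∼ = Box(b)`**;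
  and `dominated_of_unimodular`: a norm-unimodular trace-dual pair is automatically ORTHOGONAL (`‖x_m·b_m‖ ≤ ‖x‖`: `x_m = Tr(x·d_m)` and `‖Tr y‖ ≤ ‖y‖`, E-t42
  `TameRamification.norm_trace_le_norm`), so E-t58 §2 (`box_map_of_dominated`) applies to these boxes.
* §3 **`exists_dualPair_mem_normalizedPacket_iff_box_of_not_wild`**, **`…_of_not_dvd_absRamificationIdx`** — at EVERY packet whose slots are TAMELY ramified
  (`Tr(𝒪_{k_i}) = ℤ_p`, equivalently `p ∤ e_i` — abc-iut-E-t42 `TameRamification.not_wild_of_not_dvd_absRamificationIdx`; ANY residue degrees `f_i`, any mix of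
  fields) there are norm-unimodular trace-dual pairs of slot bases (`TameDualPair.exists_normUnimodular_dualPair_of_not_wild`) — ORTHOGONAL by §2 — hence `(R_I)^∼ = Box`.
The radical power basis of gen 19 is the instance `d_j = π^{−j}/e` (`Tr(π^{j−j′}) = e·[j = j′]` for `|j − j′| < e`, `‖e‖ = 1`); it stays BY NAME, not re-derived.
Consumer: the seat's Summits-side confinement of the Θ-region's factorwise-strip orbits (`Summit.ABC.IUTFork.Thm311.Real.…MonomialBoxSharp`, gen 19) at
packets of tame factors of ARBITRARY residue degrees.
[cite: Mochizuki2012, IUTchIV Prop. 1.1 p. 9] [cite: SerreLocalFields1979, Ch. III §3, Prop. 7] [cite: NeukirchANT1999, Ch. II (4.8)] [cite: WeilBNT1967, Ch. II §1, Prop. 3]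
-/

noncomputable section

open Module
open scoped Pointwise

namespace Literature.IUT.LogVolume

namespace MonomialBox

section Packet

variable (p : ℕ) [hp : Fact p.Prime] {I : Type} [Fintype I] [DecidableEq I]
  (k : I → Type) [∀ i, NontriviallyNormedField (k i)] [∀ i, NormedAlgebra ℚ_[p] (k i)]
  [∀ i, IsUltrametricDist (k i)] [∀ i, ProperSpace (k i)]
variable {κ : I → Type} [∀ i, Fintype (κ i)] [∀ i, DecidableEq (κ i)]
  (b : ∀ i, Basis (κ i) ℚ_[p] (k i)) (d : ∀ i, κ i → k i)

/-! ## §1 Every packet: the coordinates of `(R_I)^∼` are bounded by the norms of the trace-dual basis -/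

/-- **`(R_I)^∼` LIES IN THE DUAL-BASIS BOX (every packet, wild slots allowed).**  For `ℚ_p`-bases `b^{(i)}` of the slots with trace-dual families
`d^{(i)}` (`Tr_{k_i/ℚ_p}(d_m·b_{m'}) = δ_{m m'}`), every `z ∈ (R_I)^∼` has tensor-basis coordinates `‖z_J‖ ≤ ∏_i ‖d^{(i)}_{J_i}‖`: the weighted embedding
sum `Σ_{σ ∈ ∏_i Hom(k_i, ℚ̄_p)} (⊗σ_i)(z)·∏_i σ_i(d_{J_i})` equals `z_J` (expand `z`, swap the sums, `Σ_{σ_i} σ_i(b_{J′_i} d_{J_i}) = Tr(b_{J′_i} d_{J_i}) = δ`),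
each `(⊗σ_i)(z)` is `ℤ_p`-integral of norm `≤ 1`, and `‖σ_i(d)‖ = ‖d‖`.  A coordinatewise companion of [IUTchIV] Prop. 1.1's different bound.
[cite: Mochizuki2012, IUTchIV Prop. 1.1 p. 9] [cite: SerreLocalFields1979, Ch. III §3, Prop. 7] [cite: NeukirchANT1999, Ch. II (4.8)] -/
theorem norm_repr_le_prod_norm_of_traceDual [Nonempty I]
    (hbd : ∀ i (m m' : κ i), Algebra.trace ℚ_[p] (k i) (d i m * b i m') = if m' = m then 1 else 0)
    {z : PacketAlgebra p k} (hz : z ∈ normalizedPacket p k) (J : Π i, κ i) :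
    ‖(Basis.piTensorProduct b).repr z J‖ ≤ ∏ i, ‖d i (J i)‖ := by
  classical
  haveI : ∀ i, FiniteDimensional ℚ_[p] (k i) := fun i => finiteDimensional p (k i)
  -- the product embeddings `Φ σ = ⊗_i σ_i`
  have hΦex : ∀ σ : Π i, (k i →ₐ[ℚ_[p]] PadicAlgCl p), ∃ Φ : PacketAlgebra p k →ₐ[ℚ_[p]] PadicAlgCl p,
      ∀ x : Π i, k i, Φ (purePacket p k x) = ∏ i, σ i (x i) := fun σ => exists_algHom_of_algHom p k σ
  choose Φ hΦ using hΦex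
  have hint : ∀ σ, ‖Φ σ z‖ ≤ 1 := fun σ =>
    (Literature.NumberTheory.GaloisRepresentations.PadicAlgCl.norm_le_one_iff_isIntegral _).mpr
      ((isIntegral_of_mem_normalizedPacket p k hz).map ((Φ σ).restrictScalars ℤ_[p]))
  -- coordinates and the expansion of `Φ σ z`
  set c : (Π i, κ i) → ℚ_[p] := fun J' => (Basis.piTensorProduct b).repr z J' with hc
  have hexp : ∀ σ : Π i, (k i →ₐ[ℚ_[p]] PadicAlgCl p), Φ σ z = ∑ J', c J' • ∏ i, σ i (b i (J' i)) := by
    intro σ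
    conv_lhs => rw [← (Basis.piTensorProduct b).sum_repr z]
    rw [map_sum]
    refine Finset.sum_congr rfl fun J' _ => ?_
    rw [map_smul, Basis.piTensorProduct_apply, ← purePacket, hΦ]
  -- the weighted embedding sum and its norm
  set T : PadicAlgCl p := ∑ σ : Π i, (k i →ₐ[ℚ_[p]] PadicAlgCl p), Φ σ z * ∏ i, σ i (d i (J i)) with hT
  have hTle : ‖T‖ ≤ ∏ i, ‖d i (J i)‖ := by
    refine IsUltrametricDist.norm_sum_le_of_forall_le_of_nonneg (Finset.prod_nonneg fun i _ => norm_nonneg _) fun σ _ => ?_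
    rw [norm_mul, norm_prod, Finset.prod_congr rfl (fun i _ => norm_map_algHom (σ i) (d i (J i)))]
    exact mul_le_of_le_one_left (Finset.prod_nonneg fun i _ => norm_nonneg _) (hint σ)
  -- trace orthogonality through the embeddings, slot by slot
  have htr : ∀ i (m m' : κ i), ∑ τ : k i →ₐ[ℚ_[p]] PadicAlgCl p, τ (b i m' * d i m) = if m' = m then 1 else 0 := by
    intro i m m'
    rw [← trace_eq_sum_embeddings (PadicAlgCl p), mul_comm, hbd i m m']
    split_ifs <;> simp
  -- evaluation of `T`
  have h1 : T = ∑ J', c J' • ∑ σ : Π i, (k i →ₐ[ℚ_[p]] PadicAlgCl p), ∏ i, σ i (b i (J' i) * d i (J i)) := by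
    rw [hT, Finset.sum_congr rfl (fun σ _ => by rw [hexp σ, Finset.sum_mul]), Finset.sum_comm]
    refine Finset.sum_congr rfl fun J' _ => ?_
    rw [Finset.smul_sum]
    refine Finset.sum_congr rfl fun σ _ => ?_
    rw [smul_mul_assoc, ← Finset.prod_mul_distrib]
    exact congrArg _ (Finset.prod_congr rfl fun i _ => by rw [map_mul])
  have h2 : ∀ J' : Π i, κ i, ∑ σ : Π i, (k i →ₐ[ℚ_[p]] PadicAlgCl p), ∏ i, σ i (b i (J' i) * d i (J i)) =
      ∏ i, (if J' i = J i then (1 : PadicAlgCl p) else 0) := by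
    intro J'
    rw [← Finset.prod_congr rfl (fun i _ => htr i (J i) (J' i)), Finset.prod_univ_sum]
    simp only [Fintype.piFinset_univ]
  have hTeval : T = algebraMap ℚ_[p] (PadicAlgCl p) (c J) := by
    rw [h1, Finset.sum_congr rfl (fun J' _ => by rw [h2 J']), Finset.sum_eq_single J]
    · rw [Finset.prod_eq_one (fun i _ => if_pos rfl), Algebra.algebraMap_eq_smul_one]
    · intro J' _ hJ'
      obtain ⟨i, hi⟩ : ∃ i, J' i ≠ J i := by
        by_contra hall; push Not at hall; exact hJ' (funext hall)
      rw [Finset.prod_eq_zero (Finset.mem_univ i) (if_neg hi), smul_zero]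
    · intro hJ; exact absurd (Finset.mem_univ J) hJ
  have hnc : ‖c J‖ = ‖T‖ := by rw [hTeval, norm_algebraMap']
  change ‖c J‖ ≤ _
  rw [hnc]
  exact hTle

/-! ## §2 Norm-unimodular trace-dual pairs: `(R_I)^∼` = Box -/

/-- **`(R_I)^∼ ⊆ Box(b)` at a NORM-UNIMODULAR trace-dual pair** (`‖b_m‖·‖d_m‖ ≤ 1` in every slot): `‖z_J‖·∏_i ‖b_{J_i}‖ ≤ ∏_i ‖d_{J_i}‖·‖b_{J_i}‖ ≤ 1` by §1.
[cite: Mochizuki2012, IUTchIV Prop. 1.1 p. 9] [cite: WeilBNT1967, Ch. II §1, Prop. 3] -/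
theorem box_of_mem_normalizedPacket_of_unimodular [Nonempty I]
    (hbd : ∀ i (m m' : κ i), Algebra.trace ℚ_[p] (k i) (d i m * b i m') = if m' = m then 1 else 0)
    (hnorm : ∀ i (m : κ i), ‖b i m‖ * ‖d i m‖ ≤ 1)
    {z : PacketAlgebra p k} (hz : z ∈ normalizedPacket p k) (J : Π i, κ i) :
    ‖(Basis.piTensorProduct b).repr z J‖ * ∏ i, ‖b i (J i)‖ ≤ 1 :=
  calc ‖(Basis.piTensorProduct b).repr z J‖ * ∏ i, ‖b i (J i)‖
      ≤ (∏ i, ‖d i (J i)‖) * ∏ i, ‖b i (J i)‖ :=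
        mul_le_mul_of_nonneg_right (norm_repr_le_prod_norm_of_traceDual p k b d hbd hz J) (Finset.prod_nonneg fun i _ => norm_nonneg _)
    _ = ∏ i, (‖b i (J i)‖ * ‖d i (J i)‖) := by rw [← Finset.prod_mul_distrib]; exact Finset.prod_congr rfl fun i _ => mul_comm _ _
    _ ≤ 1 := Finset.prod_le_one (fun i _ => by positivity) fun i _ => hnorm i (J i)

/-- **`(R_I)^∼ = Box(b)` at a norm-unimodular trace-dual pair**: membership in the normalised packet is the coordinate condition
`‖z_J‖·∏_i ‖b^{(i)}_{J_i}‖ ≤ 1 ∀J` (§2 + E-t58's `mem_normalizedPacket_of_box`). [cite: Mochizuki2012, IUTchIV Prop. 1.1 p. 9] -/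
theorem mem_normalizedPacket_iff_box_of_unimodular [Nonempty I]
    (hbd : ∀ i (m m' : κ i), Algebra.trace ℚ_[p] (k i) (d i m * b i m') = if m' = m then 1 else 0)
    (hnorm : ∀ i (m : κ i), ‖b i m‖ * ‖d i m‖ ≤ 1) (z : PacketAlgebra p k) :
    z ∈ normalizedPacket p k ↔ ∀ J : Π i, κ i, ‖(Basis.piTensorProduct b).repr z J‖ * ∏ i, ‖b i (J i)‖ ≤ 1 :=
  ⟨fun hz => box_of_mem_normalizedPacket_of_unimodular p k b d hbd hnorm hz, mem_normalizedPacket_of_box p k b⟩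

end Packet

/-! ### A norm-unimodular trace-dual pair is orthogonal -/

section Slot

variable {p : ℕ} [Fact p.Prime] {L : Type} [NontriviallyNormedField L] [NormedAlgebra ℚ_[p] L] [IsUltrametricDist L] [ProperSpace L]
variable {κ₀ : Type} [Fintype κ₀] [DecidableEq κ₀] (b₀ d₀ : Basis κ₀ ℚ_[p] L)

/-- **A norm-unimodular trace-dual pair of bases is ORTHOGONAL (norm-dominated):** `‖x_m·b_m‖ ≤ ‖x‖` for every `x` and every coordinate `x_m` of `x` in `b`
— since `x_m = Tr(x·d_m)` (`dualPair_repr_left`), `‖Tr y‖ ≤ ‖y‖` (abc-iut-E-t42 `TameRamification.norm_trace_le_norm`) and `‖b_m‖·‖d_m‖ ≤ 1`.  So the boxes of §2–§3 are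
boxes of orthogonal bases in Weil's sense, to which E-t58's `box_map_of_dominated` applies. [cite: WeilBNT1967, Ch. II §1, Prop. 3] [cite: NeukirchANT1999, Ch. II (4.8)] -/
theorem dominated_of_unimodular (hbd : ∀ i j, Algebra.trace ℚ_[p] L (d₀ i * b₀ j) = if j = i then 1 else 0)
    (hnorm : ∀ m, ‖b₀ m‖ * ‖d₀ m‖ ≤ 1) (x : L) (m : κ₀) : ‖b₀.repr x m • b₀ m‖ ≤ ‖x‖ := by
  rw [norm_smul, dualPair_repr_left b₀ d₀ hbd x m]
  calc ‖Algebra.trace ℚ_[p] L (x * d₀ m)‖ * ‖b₀ m‖ ≤ ‖x * d₀ m‖ * ‖b₀ m‖ :=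
        mul_le_mul_of_nonneg_right (TameRamification.norm_trace_le_norm (x * d₀ m)) (norm_nonneg _)
    _ ≤ ‖x‖ * (‖b₀ m‖ * ‖d₀ m‖) := by rw [norm_mul]; nlinarith [norm_nonneg x, norm_nonneg (d₀ m), norm_nonneg (b₀ m)]
    _ ≤ ‖x‖ := mul_le_of_le_one_right (norm_nonneg _) (hnorm m)

end Slot

section TamePacket

variable (p : ℕ) [hp : Fact p.Prime] {I : Type} [Fintype I] [DecidableEq I]
  (k : I → Type) [∀ i, NontriviallyNormedField (k i)] [∀ i, NormedAlgebra ℚ_[p] (k i)]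
  [∀ i, IsUltrametricDist (k i)] [∀ i, ProperSpace (k i)]

/-! ## §3 Tame packets of ANY residue degrees: a norm-unimodular pair exists in every slot, so `(R_I)^∼` is a box -/

/-- **At every packet of NOT-WILD slots `(R_I)^∼` IS A BOX.**  If no slot has a wild trace form (`¬ ∀ x, ‖x‖ ≤ 1 → ‖Tr x‖ < 1`, i.e. `Tr(𝒪_{k_i}) = ℤ_p`:
tame ramification, ANY residue degree), then abc-iut-E-t42's `TameDualPair.exists_normUnimodular_dualPair_of_not_wild` gives in every slot `ℚ_p`-bases `b^{(i)}, d^{(i)}`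
with `Tr(d_m b_{m′}) = δ` and `‖b_m‖·‖d_m‖ ≤ 1` — ORTHOGONAL by `dominated_of_unimodular` — and `(R_I)^∼ = Box(b)` by §2.
[cite: Mochizuki2012, IUTchIV Prop. 1.1 p. 9] [cite: SerreLocalFields1979, Ch. III §3, Prop. 7] [cite: WeilBNT1967, Ch. II §1, Prop. 3] -/
theorem exists_dualPair_mem_normalizedPacket_iff_box_of_not_wild [Nonempty I]
    (hnw : ∀ i, ¬ ∀ x : k i, ‖x‖ ≤ 1 → ‖Algebra.trace ℚ_[p] (k i) x‖ < 1) :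
    ∃ (n : I → ℕ) (b d : ∀ i, Basis (Fin (n i)) ℚ_[p] (k i)),
      (∀ i (m m' : Fin (n i)), Algebra.trace ℚ_[p] (k i) (d i m * b i m') = if m' = m then 1 else 0) ∧
      (∀ i (m : Fin (n i)), ‖b i m‖ * ‖d i m‖ ≤ 1) ∧
      (∀ i (x : k i) (m : Fin (n i)), ‖(b i).repr x m • b i m‖ ≤ ‖x‖) ∧
      ∀ z : PacketAlgebra p k, z ∈ normalizedPacket p k ↔
        ∀ J : Π i, Fin (n i), ‖(Basis.piTensorProduct b).repr z J‖ * ∏ i, ‖b i (J i)‖ ≤ 1 := by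
  classical
  have hex : ∀ i, ∃ (n : ℕ) (b d : Basis (Fin n) ℚ_[p] (k i)),
      (∀ m m', Algebra.trace ℚ_[p] (k i) (d m * b m') = if m' = m then 1 else 0) ∧ ∀ m, ‖b m‖ * ‖d m‖ ≤ 1 := fun i =>
    TameDualPair.exists_normUnimodular_dualPair_of_not_wild (hnw i)
  choose n b d hbd hnorm using hex
  exact ⟨n, b, d, hbd, hnorm, fun i x m => dominated_of_unimodular (b i) (d i) (hbd i) (hnorm i) x m,
    fun z => mem_normalizedPacket_iff_box_of_unimodular p k b (fun i => ⇑(d i)) hbd hnorm z⟩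

/-- **At every packet of TAMELY RAMIFIED slots (`p ∤ e_i`, ANY residue degrees `f_i`) `(R_I)^∼` is the monomial box of a norm-unimodular trace-dual pair**
(§3 + `TameRamification.not_wild_of_not_dvd_absRamificationIdx`).  The equal-slot IUT shape `K_v ⊗ ⋯ ⊗ K_v` at a tame place `v` of any residue degree, and
mixed packets `⊗_{v ∣ p} K_v` of tame places, are covered. [cite: Mochizuki2012, IUTchIV Prop. 1.1 p. 9] [cite: SerreLocalFields1979, Ch. III §6, Prop. 13] -/
theorem exists_dualPair_mem_normalizedPacket_iff_box_of_not_dvd_absRamificationIdx [Nonempty I]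
    (hpe : ∀ i, ¬ p ∣ absRamificationIdx p (k i)) :
    ∃ (n : I → ℕ) (b d : ∀ i, Basis (Fin (n i)) ℚ_[p] (k i)),
      (∀ i (m m' : Fin (n i)), Algebra.trace ℚ_[p] (k i) (d i m * b i m') = if m' = m then 1 else 0) ∧
      (∀ i (m : Fin (n i)), ‖b i m‖ * ‖d i m‖ ≤ 1) ∧
      (∀ i (x : k i) (m : Fin (n i)), ‖(b i).repr x m • b i m‖ ≤ ‖x‖) ∧
      ∀ z : PacketAlgebra p k, z ∈ normalizedPacket p k ↔
        ∀ J : Π i, Fin (n i), ‖(Basis.piTensorProduct b).repr z J‖ * ∏ i, ‖b i (J i)‖ ≤ 1 :=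
  exists_dualPair_mem_normalizedPacket_iff_box_of_not_wild p k fun i =>
    TameRamification.not_wild_of_not_dvd_absRamificationIdx (hpe i)

end TamePacket

end MonomialBox

end Literature.IUT.LogVolume
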